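import Mathlib
import Summits.ValiantsHypothesis.ValiantsHypothesis.Theorems.LacunarySymmetroidMatrixDescartesDoorA26WallBubblingBubblingTwistedRolle

/-!
# Exponential Newton inequalities (ENS) for Descartes-saturated real exponential sums — part 1: tools and the three-class base

Helper for the line `Cruxes/DoorA26/Lines/wall_bubbling.lean` (stmt-ValiantsHypothesis-19979, `Theses.LacunarySymmetroid.DoorA26`),
obligation (M): item (v) of the soundness ledger of the second-order sieve (`Lines/wall_bubbling_M-sieve.md` §2.4 «ENS», §2.6, §5).
STATEMENT (memo §2.4): if a real exponential sum with `n` active exponent classes has `n − 1` real zeros, the points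
`(vₘ, log cₘ)`, `cₘ = |classSum vₘ| · ∏_{k ≠ m} |vₘ − vₖ|`, are in CONCAVE position.  We prove the ROBUST form the sieve consumes
(`robust_exp_newton`, in part 2 `…WallBubblingExpNewton`: a coefficient/exponent-convergent family, as in `robust_term_count`, frequently
Descartes-saturated in a fixed window ⇒ weak concavity of every triple of active LIMIT classes) and the one-sum corollary for DISTINCT zeros
(`exp_newton`, part 2).  THIS MODULE: evaluation over active classes, persistence of window zeros in the limit, twisting keeps saturation,
robust two-class sign alternation, and the THREE-CLASS BASE INEQUALITY `exp_newton_base`.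
Multiplicities are never used.  PROOF: Laguerre's twisted Rolle (twisting at an active class `w₀ ∉ {u,v,w}` and differentiating keeps
saturation by `rolle_count` and leaves the weights `c_y` invariant); at three classes two more twists give robust SIGN ALTERNATION, and
strict convexity of the three points is «middle coefficient below the weighted AM–GM threshold», forcing `A·F₀ > 0` — incompatible with
a persistent window zero (compactness).  HONEST FRAMING: elementary real analysis (folklore in spirit; nearest print: Descartes–Laguerre
for exponential sums, Braess 1986 VI.1.2; Newton's inequalities in the polynomial case); a helper of the (M) INSTRUMENT only — nothing
here bears on `DoorA26` (OPEN; (W), (M), (R) remain), on `MatrixDescartes` (18050) or on `VP ≠ VNP`.  Seat: prover val-sym-lift-p2 g17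
(lead g27 R2664/R2665/R2667), `--supports stmt-ValiantsHypothesis-19979`.
-/

-- `Summit.ValiantsHypothesis.ValiantsHypothesis.…` repeats a component by the D-0017 layout
-- (single-conjunct summit), which the `dupNamespace` linter flags; the name is mandated.
set_option linter.dupNamespace false

namespace Summit.ValiantsHypothesis.ValiantsHypothesis.Theorems.LacunarySymmetroidMatrixDescartes.WallBubbling.Bubbling

open Finset Filter Topology

variable {ι : Type*} [Fintype ι]


/-- If every active class lies in `V`, then `expSum a x t = ∑_{y ∈ V} classSum y · exp (y t)`. [folklore] -/
theorem expSum_eq_sum_over (a x : ι → ℝ) (V : Finset ℝ)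
    (hV : ∀ y, classSum a x y ≠ 0 → y ∈ V) (t : ℝ) :
    expSum a x t = ∑ y ∈ V, classSum a x y * Real.exp (y * t) := by
  classical
  rw [expSum_eq_sum_classes]
  have h1 : ∑ w ∈ Finset.univ.image x, Real.exp (w * t) * classSum a x w
      = ∑ w ∈ Finset.univ.image x ∪ V, Real.exp (w * t) * classSum a x w := by
    apply Finset.sum_subset Finset.subset_union_left
    intro w _ hw
    have : classSum a x w = 0 := by
      unfold classSum
      refine Finset.sum_eq_zero fun i _ => ?_
      rw [if_neg]
      intro h
      exact hw (h ▸ Finset.mem_image_of_mem x (Finset.mem_univ i))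
    rw [this, mul_zero]
  have h2 : ∑ y ∈ V, classSum a x y * Real.exp (y * t)
      = ∑ w ∈ Finset.univ.image x ∪ V, classSum a x w * Real.exp (w * t) := by
    apply Finset.sum_subset Finset.subset_union_right
    intro w _ hw
    have : classSum a x w = 0 := by
      by_contra h
      exact hw (hV w h)
    rw [this, zero_mul]
  rw [h1, h2]
  exact Finset.sum_congr rfl fun w _ => mul_comm _ _


/-- If a coefficient/exponent-convergent family of exponential sums frequently has a zero in `[−R, R]`, so does the
limit sum (sequential compactness + continuity). [folklore] -/
theorem exists_zero_of_frequently (a x : ℕ → ι → ℝ) (a₀ x₀ : ι → ℝ)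
    (ha : ∀ i, Tendsto (fun ν => a ν i) atTop (𝓝 (a₀ i)))
    (hx : ∀ i, Tendsto (fun ν => x ν i) atTop (𝓝 (x₀ i))) (R : ℝ)
    (h : ∃ᶠ ν in atTop, ∃ t ∈ Set.Icc (-R) R, expSum (a ν) (x ν) t = 0) :
    ∃ t ∈ Set.Icc (-R) R, expSum a₀ x₀ t = 0 := by
  obtain ⟨φ, hφ, hφP⟩ := Filter.extraction_of_frequently_atTop h
  choose t ht h0 using hφP
  obtain ⟨t₀, ht₀, ψ, hψ, hlim⟩ := isCompact_Icc.tendsto_subseq ht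
  have hsub : Tendsto (φ ∘ ψ) atTop atTop := (hφ.comp hψ).tendsto_atTop
  have key : Tendsto (fun n => expSum (a (φ (ψ n))) (x (φ (ψ n))) (t (ψ n))) atTop
      (𝓝 (expSum a₀ x₀ t₀)) := by
    unfold expSum
    apply tendsto_finsetSum
    intro i _
    have h1 : Tendsto (fun n => a (φ (ψ n)) i) atTop (𝓝 (a₀ i)) := (ha i).comp hsub
    have h2 : Tendsto (fun n => x (φ (ψ n)) i) atTop (𝓝 (x₀ i)) := (hx i).comp hsub
    have h3 : Tendsto (fun n => x (φ (ψ n)) i * t (ψ n)) atTop (𝓝 (x₀ i * t₀)) := h2.mul hlim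
    exact h1.mul ((Real.continuous_exp.tendsto _).comp h3)
  have hzero : (fun n => expSum (a (φ (ψ n))) (x (φ (ψ n))) (t (ψ n))) = fun _ => (0 : ℝ) :=
    funext fun n => h0 (ψ n)
  rw [hzero] at key
  exact ⟨t₀, ht₀, (tendsto_const_nhds_iff.mp key).symm⟩


/-- Twist at `w₀` and differentiate: a window zero set of size `≥ m + 1` of the `ν`-th sum yields one of size `≥ m`
of the twisted-differentiated sum `expSum (a ν · (x ν − w₀)) (x ν − w₀)` in the same window (Rolle). [folklore] -/
theorem frequently_zeros_twist (a x : ℕ → ι → ℝ) (w₀ R : ℝ) (m : ℕ)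
    (h : ∃ᶠ ν in atTop, ∃ Z : Finset ℝ,
      (∀ z ∈ Z, z ∈ Set.Icc (-R) R ∧ expSum (a ν) (x ν) z = 0) ∧ m + 1 ≤ Z.card) :
    ∃ᶠ ν in atTop, ∃ Z : Finset ℝ,
      (∀ z ∈ Z, z ∈ Set.Icc (-R) R ∧
        expSum (fun i => a ν i * (x ν i - w₀)) (fun i => x ν i - w₀) z = 0) ∧ m ≤ Z.card := by
  refine h.mono fun ν hν => ?_
  obtain ⟨Z, hZ, hcard⟩ := hν
  have hderiv : ∀ s, HasDerivAt (expSum (a ν) (fun i => x ν i - w₀))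
      (expSum (fun i => a ν i * (x ν i - w₀)) (fun i => x ν i - w₀) s) s :=
    fun s => hasDerivAt_expSum (a ν) (fun i => x ν i - w₀) s
  have hZ' : ∀ z ∈ Z, z ∈ Set.Icc (-R) R ∧ expSum (a ν) (fun i => x ν i - w₀) z = 0 := by
    intro z hz
    refine ⟨(hZ z hz).1, ?_⟩
    have := expSum_twist (a ν) (x ν) w₀ z
    rw [(hZ z hz).2, mul_zero] at this
    exact this.symm
  obtain ⟨Z', hcardZ', hZ'0⟩ := rolle_count hderiv (-R) R Z hZ'
  refine ⟨Z', hZ'0, ?_⟩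
  have h1 : m + 1 ≤ Z.card := hcard
  have h2 : Z.card ≤ Z'.card + 1 := hcardZ'
  omega

/-- From a zero set of size `≥ 1` to a zero. [folklore] -/
theorem frequently_zero_of_card (a x : ℕ → ι → ℝ) (R : ℝ)
    (h : ∃ᶠ ν in atTop, ∃ Z : Finset ℝ,
      (∀ z ∈ Z, z ∈ Set.Icc (-R) R ∧ expSum (a ν) (x ν) z = 0) ∧ 1 ≤ Z.card) :
    ∃ᶠ ν in atTop, ∃ t ∈ Set.Icc (-R) R, expSum (a ν) (x ν) t = 0 := by
  refine h.mono fun ν hν => ?_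
  obtain ⟨Z, hZ, hcard⟩ := hν
  obtain ⟨z, hz⟩ := Finset.card_pos.mp (show 0 < Z.card by omega)
  exact ⟨z, (hZ z hz).1, (hZ z hz).2⟩


/-- If the limit has exactly the two active classes `s₁ ≠ s₂` and the family frequently has a window zero, the two
limit class sums have OPPOSITE signs. [folklore] -/
theorem classSum_mul_neg_of_two (a x : ℕ → ι → ℝ) (a₀ x₀ : ι → ℝ)
    (ha : ∀ i, Tendsto (fun ν => a ν i) atTop (𝓝 (a₀ i)))
    (hx : ∀ i, Tendsto (fun ν => x ν i) atTop (𝓝 (x₀ i))) {s₁ s₂ : ℝ} (hs : s₁ ≠ s₂)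
    (h₁ : classSum a₀ x₀ s₁ ≠ 0) (h₂ : classSum a₀ x₀ s₂ ≠ 0)
    (hV : ∀ y, classSum a₀ x₀ y ≠ 0 → y = s₁ ∨ y = s₂) (R : ℝ)
    (h : ∃ᶠ ν in atTop, ∃ t ∈ Set.Icc (-R) R, expSum (a ν) (x ν) t = 0) :
    classSum a₀ x₀ s₁ * classSum a₀ x₀ s₂ < 0 := by
  classical
  obtain ⟨t₀, _, ht₀⟩ := exists_zero_of_frequently a x a₀ x₀ ha hx R h
  have hV' : ∀ y, classSum a₀ x₀ y ≠ 0 → y ∈ ({s₁, s₂} : Finset ℝ) := by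
    intro y hy
    rcases hV y hy with rfl | rfl <;> simp
  rw [expSum_eq_sum_over a₀ x₀ {s₁, s₂} hV' t₀, Finset.sum_pair hs] at ht₀
  have e₁ := Real.exp_pos (s₁ * t₀)
  have e₂ := Real.exp_pos (s₂ * t₀)
  have hsq : 0 < classSum a₀ x₀ s₂ * classSum a₀ x₀ s₂ := mul_self_pos.mpr h₂
  by_contra hcon
  rw [not_lt] at hcon
  have h1 : classSum a₀ x₀ s₁ * classSum a₀ x₀ s₂ * Real.exp (s₁ * t₀) +
      classSum a₀ x₀ s₂ * classSum a₀ x₀ s₂ * Real.exp (s₂ * t₀) =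
      classSum a₀ x₀ s₂ * (classSum a₀ x₀ s₁ * Real.exp (s₁ * t₀) +
        classSum a₀ x₀ s₂ * Real.exp (s₂ * t₀)) := by ring
  rw [ht₀, mul_zero] at h1
  have t1 := mul_nonneg hcon e₁.le
  have t2 := mul_pos hsq e₂
  linarith


/-- **ENS, base case.**  Three active limit classes `u < v < w` with class sums `A, B, C` and a family that frequently
carries two distinct window zeros: then `(w − v)·log(|A|(v−u)(w−u)) + (v − u)·log(|C|(w−u)(w−v)) ≤
(w − u)·log(|B|(v−u)(w−v))`.  Proof: twisted Rolle at `u` and at `w` gives `BC < 0`, `AB < 0`; if the inequality failed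
strictly, weighted AM–GM (concavity of `log`, weights `(w−v)/(w−u)`, `(v−u)/(w−u)`) gives `A·F₀(t) > 0` for all `t`, so the
limit has no zero — contradicting the persistent window zeros. [folklore] -/
theorem exp_newton_base (a x : ℕ → ι → ℝ) (a₀ x₀ : ι → ℝ)
    (ha : ∀ i, Tendsto (fun ν => a ν i) atTop (𝓝 (a₀ i)))
    (hx : ∀ i, Tendsto (fun ν => x ν i) atTop (𝓝 (x₀ i))) {u v w : ℝ} (huv : u < v) (hvw : v < w)
    (hu0 : classSum a₀ x₀ u ≠ 0) (hv0 : classSum a₀ x₀ v ≠ 0) (hw0 : classSum a₀ x₀ w ≠ 0)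
    (hV : ∀ y, classSum a₀ x₀ y ≠ 0 → y = u ∨ y = v ∨ y = w) (R : ℝ)
    (hsat : ∃ᶠ ν in atTop, ∃ Z : Finset ℝ,
      (∀ z ∈ Z, z ∈ Set.Icc (-R) R ∧ expSum (a ν) (x ν) z = 0) ∧ 2 ≤ Z.card) :
    (w - v) * Real.log (|classSum a₀ x₀ u| * ((v - u) * (w - u))) +
      (v - u) * Real.log (|classSum a₀ x₀ w| * ((w - u) * (w - v))) ≤
    (w - u) * Real.log (|classSum a₀ x₀ v| * ((v - u) * (w - v))) := by
  classical
  set A := classSum a₀ x₀ u with hA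
  set B := classSum a₀ x₀ v with hB
  set C := classSum a₀ x₀ w with hC
  have huw : u < w := huv.trans hvw
  have hα : 0 < v - u := sub_pos.mpr huv
  have hβ : 0 < w - v := sub_pos.mpr hvw
  have hγ : 0 < w - u := sub_pos.mpr huw
  -- twisted data at a point `p`: still convergent, and frequently with a window zero (Rolle)
  have ha' : ∀ p i, Tendsto (fun ν => a ν i * (x ν i - p)) atTop (𝓝 (a₀ i * (x₀ i - p))) :=
    fun p i => (ha i).mul ((hx i).sub_const p)
  have hx' : ∀ p i, Tendsto (fun ν => x ν i - p) atTop (𝓝 (x₀ i - p)) := fun p i => (hx i).sub_const p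
  have hfz : ∀ p, ∃ᶠ ν in atTop, ∃ t ∈ Set.Icc (-R) R,
      expSum (fun i => a ν i * (x ν i - p)) (fun i => x ν i - p) t = 0 :=
    fun p => frequently_zero_of_card _ _ R (frequently_zeros_twist a x p R 1 hsat)
  have cst : ∀ p s : ℝ, classSum (fun i => a₀ i * (x₀ i - p)) (fun i => x₀ i - p) s
      = s * classSum a₀ x₀ (s + p) := fun p s => classSum_twist a₀ x₀ p s
  have hcl : ∀ p s, classSum (fun i => a₀ i * (x₀ i - p)) (fun i => x₀ i - p) s ≠ 0 →
      s ≠ 0 ∧ (s + p = u ∨ s + p = v ∨ s + p = w) := by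
    intro p s hs
    rw [cst] at hs
    exact ⟨fun h => by rw [h, zero_mul] at hs; exact hs rfl, hV _ (right_ne_zero_of_mul hs)⟩
  -- Step 1: `B * C < 0` (twist at `u`); Step 2: `A * B < 0` (twist at `w`)
  have hBC : B * C < 0 := by
    have h := classSum_mul_neg_of_two _ _ _ _ (ha' u) (hx' u) (s₁ := v - u) (s₂ := w - u) (by linarith)
      (by rw [cst, sub_add_cancel]; exact mul_ne_zero hα.ne' hv0)
      (by rw [cst, sub_add_cancel]; exact mul_ne_zero hγ.ne' hw0) ?_ R (hfz u)
    · rw [cst, cst, sub_add_cancel, sub_add_cancel, ← hB, ← hC] at h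
      by_contra hcon
      rw [not_lt] at hcon
      nlinarith [mul_nonneg (mul_pos hα hγ).le hcon]
    · intro y hy
      obtain ⟨hy0, h | h | h⟩ := hcl u y hy
      · exact absurd (by linarith) hy0
      · left; linarith
      · right; linarith
  have hAB : A * B < 0 := by
    have h := classSum_mul_neg_of_two _ _ _ _ (ha' w) (hx' w) (s₁ := u - w) (s₂ := v - w) (by linarith)
      (by rw [cst, sub_add_cancel]; exact mul_ne_zero (by linarith) hu0)
      (by rw [cst, sub_add_cancel]; exact mul_ne_zero (by linarith) hv0) ?_ R (hfz w)
    · rw [cst, cst, sub_add_cancel, sub_add_cancel, ← hA, ← hB] at h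
      by_contra hcon
      rw [not_lt] at hcon
      nlinarith [mul_nonneg (mul_pos hγ hβ).le hcon]
    · intro y hy
      obtain ⟨hy0, h | h | h⟩ := hcl w y hy
      · left; linarith
      · right; linarith
      · exact absurd (by linarith) hy0
  have hAC : 0 < A * C := by
    have : 0 < (A * B) * (B * C) := mul_pos_of_neg_of_neg hAB hBC
    nlinarith [mul_self_pos.mpr hv0]
  -- Step 3: the limit sum and the AM–GM contradiction
  by_contra hlt
  rw [not_le] at hlt
  have hVuvw : ∀ y, classSum a₀ x₀ y ≠ 0 → y ∈ ({u, v, w} : Finset ℝ) := by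
    intro y hy
    rcases hV y hy with rfl | rfl | rfl <;> simp
  have hF : ∀ t, expSum a₀ x₀ t = A * Real.exp (u * t) + B * Real.exp (v * t) + C * Real.exp (w * t) := by
    intro t
    rw [expSum_eq_sum_over a₀ x₀ _ hVuvw t, Finset.sum_insert (by simp [huv.ne, huw.ne]),
      Finset.sum_pair hvw.ne, add_assoc]
  -- logs of the data
  have hAne : A ≠ 0 := hu0
  have hBne : B ≠ 0 := hv0
  have hCne : C ≠ 0 := hw0
  have hApos : 0 < |A| := abs_pos.mpr hAne
  have hBpos : 0 < |B| := abs_pos.mpr hBne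
  have hCpos : 0 < |C| := abs_pos.mpr hCne
  set lA := Real.log |A| with hlA
  set lB := Real.log |B| with hlB
  set lC := Real.log |C| with hlC
  set lp := Real.log (v - u) with hlp
  set lq := Real.log (w - v) with hlq
  set lr := Real.log (w - u) with hlr
  have hlt' : (w - u) * (lB + (lp + lq)) < (w - v) * (lA + (lp + lr)) + (v - u) * (lC + (lr + lq)) := by
    have e1 : Real.log (|A| * ((v - u) * (w - u))) = lA + (lp + lr) := by
      rw [Real.log_mul hApos.ne' (mul_pos hα hγ).ne', Real.log_mul hα.ne' hγ.ne']
    have e2 : Real.log (|C| * ((w - u) * (w - v))) = lC + (lr + lq) := by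
      rw [Real.log_mul hCpos.ne' (mul_pos hγ hβ).ne', Real.log_mul hγ.ne' hβ.ne']
    have e3 : Real.log (|B| * ((v - u) * (w - v))) = lB + (lp + lq) := by
      rw [Real.log_mul hBpos.ne' (mul_pos hα hβ).ne', Real.log_mul hα.ne' hβ.ne']
    rw [e1, e2, e3] at hlt
    exact hlt
  -- the window zero of the limit
  have hzero : ∃ t ∈ Set.Icc (-R) R, expSum a₀ x₀ t = 0 :=
    exists_zero_of_frequently a x a₀ x₀ ha hx R
      (frequently_zero_of_card a x R (hsat.mono fun ν ⟨Z, hZ, hc⟩ => ⟨Z, hZ, by omega⟩))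
  obtain ⟨t, _, ht⟩ := hzero
  rw [hF] at ht
  -- weights
  set wl := (w - v) / (w - u) with hwl
  set wm := (v - u) / (w - u) with hwm
  have hwlpos : 0 < wl := div_pos hβ hγ
  have hwmpos : 0 < wm := div_pos hα hγ
  have hwlm : wl + wm = 1 := by
    rw [hwl, hwm, ← add_div, div_eq_one_iff_eq hγ.ne']
    ring
  -- `P = A² e^{ut}`, `Q = AC e^{wt}`
  set P := A * A * Real.exp (u * t) with hP
  set Q := A * C * Real.exp (w * t) with hQ
  have hPpos : 0 < P := mul_pos (mul_self_pos.mpr hAne) (Real.exp_pos _)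
  have hQpos : 0 < Q := mul_pos hAC (Real.exp_pos _)
  -- concavity of log
  have hconc : wl * Real.log (P / wl) + wm * Real.log (Q / wm) ≤ Real.log (P + Q) := by
    have := (strictConcaveOn_log_Ioi.concaveOn).2 (Set.mem_Ioi.mpr (div_pos hPpos hwlpos))
      (Set.mem_Ioi.mpr (div_pos hQpos hwmpos)) hwlpos.le hwmpos.le hwlm
    simp only [smul_eq_mul] at this
    have e1 : wl * (P / wl) = P := by field_simp
    have e2 : wm * (Q / wm) = Q := by field_simp
    rw [e1, e2] at this
    exact this
  -- expand the logs
  have hlogP : Real.log (P / wl) = 2 * lA + u * t - (lq - lr) := by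
    rw [Real.log_div hPpos.ne' hwlpos.ne', hP, Real.log_mul (mul_self_ne_zero.mpr hAne) (Real.exp_pos _).ne',
      Real.log_exp, ← sq, ← sq_abs, Real.log_pow, hwl, Real.log_div hβ.ne' hγ.ne']
    push_cast
    ring
  have hlogQ : Real.log (Q / wm) = lA + lC + w * t - (lp - lr) := by
    rw [Real.log_div hQpos.ne' hwmpos.ne', hQ, Real.log_mul (mul_ne_zero hAne hCne) (Real.exp_pos _).ne',
      Real.log_exp, Real.log_mul hAne hCne, ← Real.log_abs A, ← Real.log_abs C, hwm,
      Real.log_div hα.ne' hγ.ne']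
  have hnegAB : 0 < -(A * B) := by linarith
  have hlogAB : Real.log (-(A * B) * Real.exp (v * t)) = lA + lB + v * t := by
    rw [Real.log_mul hnegAB.ne' (Real.exp_pos _).ne', Real.log_exp,
      show -(A * B) = |A| * |B| by rw [← abs_mul, abs_of_neg hAB], Real.log_mul hApos.ne' hBpos.ne']
  -- the key comparison of logs
  have key : Real.log (-(A * B) * Real.exp (v * t)) < wl * Real.log (P / wl) + wm * Real.log (Q / wm) := by
    rw [hlogAB, hlogP, hlogQ, hwl, hwm]
    rw [div_mul_eq_mul_div, div_mul_eq_mul_div, ← add_div, lt_div_iff₀ hγ]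
    nlinarith [hlt']
  have hcmp : -(A * B) * Real.exp (v * t) < P + Q := by
    have := key.trans_le hconc
    exact (Real.log_lt_log_iff (mul_pos hnegAB (Real.exp_pos _)) (add_pos hPpos hQpos)).mp this
  -- but `A · F₀(t) = 0`
  have hAF : A * (A * Real.exp (u * t) + B * Real.exp (v * t) + C * Real.exp (w * t)) = 0 := by
    rw [ht, mul_zero]
  have : P + Q + A * B * Real.exp (v * t) = 0 := by
    rw [hP, hQ]; linarith [hAF]
  linarith

end Summit.ValiantsHypothesis.ValiantsHypothesis.Theorems.LacunarySymmetroidMatrixDescartes.WallBubbling.Bubbling
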